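import Literature.MathematicalPhysics.QuantumFieldTheory.RadialProductProfiles
import Literature.MathematicalPhysics.QuantumFieldTheory.OSSkeletonPullback
import Literature.Analysis.Matrix.DeterminantNormBound
import Literature.Analysis.Fourier.FourierLinearChange
import HarnessLib

/-!
# Frame profiles: the real slices of the product radial kernels in a frame, with the Jacobian absorbed

Topic `Literature/MathematicalPhysics/QuantumFieldTheory`; support file (all proved; the frame map,
its Jacobian and the profiles as definitions; no named facts) for the mean-value step (6.5)–(6.7)
of Osterwalder–Schrader II, Ch. VI.1 (Comm. Math. Phys. 42 (1975)) with explicit constants. The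
polydisc of the mean value property is taken along the frame directions `ê_μ` of every point, so
that the kernel is a product over the points `j` of radial functions of the frame coordinates
`c_j ∈ ℝᵈ` of the displacement `y_j − X_j = frameMap c_j = ∑_μ c_{jμ} ê_μ`. Rewriting the
`c`-integral as a configuration-space pairing costs the Jacobian `|det frameMap|⁻¹` **per point**,
which is absorbed into the per-point **frame profiles**
`frameProfile v_j (y) = J · prodProfile v_j (frameMap⁻¹ y)` (`J = frameJac = |det frameMap|⁻¹ ≤ ‖frameMap⁻¹‖ᵈ`):

* `frameMap ê hli`, `frameMap_apply`; `frameJac`, `frameJac_pos`, `frameJac_le`;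
* `frameMapPi`, `det_frameMapPi`, `integral_comp_frameMapPi_add` — the blockwise change of
  variables `∫ G(X + frameMap∘c) dc = Jⁿ ∫ G`;
* `frameProfile`, `frameProfile_apply`, `tsupport_frameProfile_subset`, `seminorm_frameProfile_le`
  (geometric seminorm bounds, uniform in `v`);
* `integral_mul_prod_prodProfile_eq` — **the smearing identity**
  `∫ F(X + frameMap∘c) ∏ⱼ prodProfile vⱼ (cⱼ) dc = ∫ F(y) ∏ⱼ frameProfile vⱼ (yⱼ − Xⱼ) dy`.

## References

* K. Osterwalder, R. Schrader, *Axioms for Euclidean Green's functions II*, Comm. Math. Phys. 42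
  (1975) 281–305, Ch. V.1 (5.6), Ch. VI.1 (6.5)–(6.7). [OsterwalderSchraderCMP1975]
-/

noncomputable section

open MeasureTheory Set Metric Module
open scoped SchwartzMap

namespace Literature.MathematicalPhysics.QuantumFieldTheory

open Literature.Analysis.Distribution Literature.Analysis.FunctionSpaces Literature.Analysis.Matrix

variable {d : ℕ} (ê : Fin d → EuclideanSpace ℝ (Fin d)) (hli : LinearIndependent ℝ ê)

/-! ### The frame map and its Jacobian -/

/-- **The frame map** `c ↦ ∑_μ c_μ ê_μ` as an automorphism of `EuclideanSpace ℝ (Fin d)`. [cite: OsterwalderSchraderCMP1975, Ch. V.1 (5.6)] -/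
def frameMap : EuclideanSpace ℝ (Fin d) ≃L[ℝ] EuclideanSpace ℝ (Fin d) :=
  (EuclideanSpace.equiv (Fin d) ℝ).trans (dirMap ê hli).toContinuousLinearEquiv

/-- Values of the frame map. [folklore] -/
theorem frameMap_apply (c : EuclideanSpace ℝ (Fin d)) : frameMap ê hli c = ∑ μ, c μ • ê μ := by
  simp [frameMap, dirMap_apply]

/-- **The Jacobian** `J = |det frameMap|⁻¹`. [folklore] -/
def frameJac : ℝ := |(LinearMap.det (frameMap ê hli : EuclideanSpace ℝ (Fin d) →ₗ[ℝ] EuclideanSpace ℝ (Fin d)))⁻¹|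

/-- The determinant of the frame map is nonzero. [folklore] -/
theorem det_frameMap_ne_zero : LinearMap.det (frameMap ê hli : EuclideanSpace ℝ (Fin d) →ₗ[ℝ] EuclideanSpace ℝ (Fin d)) ≠ 0 :=
  (LinearEquiv.isUnit_det' ((frameMap ê hli).toLinearEquiv : EuclideanSpace ℝ (Fin d) ≃ₗ[ℝ] EuclideanSpace ℝ (Fin d))).ne_zero

/-- `J > 0`. [folklore] -/
theorem frameJac_pos : 0 < frameJac ê hli := abs_pos.2 (inv_ne_zero (det_frameMap_ne_zero ê hli))

/-- `J ≥ 0`. [folklore] -/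
theorem frameJac_nonneg : 0 ≤ frameJac ê hli := abs_nonneg _

/-- **`J ≤ ‖frameMap⁻¹‖ᵈ`** (`d ≥ 1`). [folklore] -/
theorem frameJac_le [NeZero d] : frameJac ê hli ≤ ‖((frameMap ê hli).symm : EuclideanSpace ℝ (Fin d) →L[ℝ] EuclideanSpace ℝ (Fin d))‖ ^ d := by
  haveI : Nontrivial (EuclideanSpace ℝ (Fin d)) := by
    have : 0 < Module.finrank ℝ (EuclideanSpace ℝ (Fin d)) := by rw [finrank_euclideanSpace_fin]; exact Nat.pos_of_ne_zero (NeZero.ne d)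
    exact Module.nontrivial_of_finrank_pos this
  have h := abs_det_inv_le_norm_symm_pow (frameMap ê hli)
  rwa [finrank_euclideanSpace_fin] at h

/-! ### The blockwise frame map and the change of variables -/

/-- The blockwise frame map on `n`-point configurations. [folklore] -/
def frameMapPi (n : ℕ) : (Fin n → EuclideanSpace ℝ (Fin d)) ≃L[ℝ] (Fin n → EuclideanSpace ℝ (Fin d)) :=
  ContinuousLinearEquiv.piCongrRight fun _ : Fin n => frameMap ê hli

/-- Values of the blockwise frame map. [folklore] -/
@[simp] theorem frameMapPi_apply (n : ℕ) (c : Fin n → EuclideanSpace ℝ (Fin d)) (j : Fin n) :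
    frameMapPi ê hli n c j = frameMap ê hli (c j) := rfl

/-- **The determinant of the blockwise map is the `n`-th power.** [folklore] -/
theorem det_frameMapPi (n : ℕ) :
    LinearMap.det (frameMapPi ê hli n : (Fin n → EuclideanSpace ℝ (Fin d)) →ₗ[ℝ] (Fin n → EuclideanSpace ℝ (Fin d))) =
      (LinearMap.det (frameMap ê hli : EuclideanSpace ℝ (Fin d) →ₗ[ℝ] EuclideanSpace ℝ (Fin d))) ^ n := by
  have hpi : (frameMapPi ê hli n : (Fin n → EuclideanSpace ℝ (Fin d)) →ₗ[ℝ] (Fin n → EuclideanSpace ℝ (Fin d))) =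
      LinearMap.pi fun i : Fin n => (frameMap ê hli : EuclideanSpace ℝ (Fin d) →ₗ[ℝ] EuclideanSpace ℝ (Fin d)).comp
        (LinearMap.proj i) := by
    ext c j
    rfl
  rw [hpi, LinearMap.det_pi, Finset.prod_const, Finset.card_univ, Fintype.card_fin]

/-- **Blockwise change of variables**: `∫ G(X + frameMap∘c) dc = Jⁿ • ∫ G(y) dy`. [folklore] -/
theorem integral_comp_frameMapPi_add {F : Type*} [NormedAddCommGroup F] [NormedSpace ℝ F] (n : ℕ)
    (X : Fin n → EuclideanSpace ℝ (Fin d)) (G : (Fin n → EuclideanSpace ℝ (Fin d)) → F) :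
    ∫ c : Fin n → EuclideanSpace ℝ (Fin d), G (fun j => X j + frameMap ê hli (c j)) = frameJac ê hli ^ n • ∫ y, G y := by
  have h1 : (fun c : Fin n → EuclideanSpace ℝ (Fin d) => G (fun j => X j + frameMap ê hli (c j))) =
      fun c => (fun y => G (X + y)) (frameMapPi ê hli n c) := by
    funext c; rfl
  rw [h1, Literature.Analysis.Fourier.integral_comp_continuousLinearEquiv volume (frameMapPi ê hli n) (fun y => G (X + y)),
    det_frameMapPi, ← inv_pow, abs_pow, integral_add_left_eq_self (μ := volume) G X]
  rfl

/-! ### The frame profiles -/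

variable (n₀ : ℕ) {r : ℝ} (hr : 0 < r)

/-- **The frame profile** at imaginary parts `v`: `y ↦ J · prodProfile n₀ r v (frameMap⁻¹ y)`. [cite: OsterwalderSchraderCMP1975, Ch. VI.1 (6.5)] -/
def frameProfile (v : Fin d → ℝ) : 𝓢(EuclideanSpace ℝ (Fin d), ℂ) :=
  (frameJac ê hli : ℝ) • SchwartzMap.compCLMOfContinuousLinearEquiv ℝ (frameMap ê hli).symm (prodProfile n₀ hr v)

/-- Values of the frame profile. [folklore] -/
theorem frameProfile_apply (v : Fin d → ℝ) (y : EuclideanSpace ℝ (Fin d)) :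
    frameProfile ê hli n₀ hr v y = (frameJac ê hli : ℂ) * prodProfile n₀ hr v ((frameMap ê hli).symm y) := by
  simp [frameProfile, Complex.real_smul]

/-- The frame profile at a frame point: `frameProfile v (frameMap c) = J · prodProfile v c`. [folklore] -/
theorem frameProfile_frameMap (v : Fin d → ℝ) (c : EuclideanSpace ℝ (Fin d)) :
    frameProfile ê hli n₀ hr v (frameMap ê hli c) = (frameJac ê hli : ℂ) * prodProfile n₀ hr v c := by
  rw [frameProfile_apply, ContinuousLinearEquiv.symm_apply_apply]

/-- **Support of the frame profile**: in the closed ball of radius `‖frameMap‖ √(2 d r)`. [folklore] -/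
theorem tsupport_frameProfile_subset (v : Fin d → ℝ) :
    tsupport (frameProfile ê hli n₀ hr v : EuclideanSpace ℝ (Fin d) → ℂ) ⊆
      closedBall 0 (‖(frameMap ê hli : EuclideanSpace ℝ (Fin d) →L[ℝ] EuclideanSpace ℝ (Fin d))‖ * Real.sqrt (2 * d * r)) := by
  refine closure_minimal (fun y hy => ?_) isClosed_closedBall
  rw [Function.mem_support, frameProfile_apply] at hy
  have hy' : prodProfile n₀ hr v ((frameMap ê hli).symm y) ≠ 0 := fun h => hy (by rw [h, mul_zero])
  have hmem := tsupport_prodProfile_subset n₀ hr v (subset_tsupport _ (Function.mem_support.2 hy'))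
  rw [mem_closedBall, dist_zero_right] at hmem ⊢
  calc ‖y‖ = ‖(frameMap ê hli) ((frameMap ê hli).symm y)‖ := by rw [ContinuousLinearEquiv.apply_symm_apply]
    _ ≤ ‖(frameMap ê hli : EuclideanSpace ℝ (Fin d) →L[ℝ] EuclideanSpace ℝ (Fin d))‖ * ‖(frameMap ê hli).symm y‖ :=
        (frameMap ê hli : EuclideanSpace ℝ (Fin d) →L[ℝ] EuclideanSpace ℝ (Fin d)).le_opNorm _
    _ ≤ _ := mul_le_mul_of_nonneg_left hmem (norm_nonneg _)

/-- **Geometric seminorm bounds of the frame profiles, uniformly in `v`** (`0 < r ≤ 1`; `k, l ≤ n₀`):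
`p_{k,l} ≤ J ‖frameMap‖ᵏ ‖frameMap⁻¹‖ˡ · (2 (n₀+1)/r)ᵈ (2√d)ᵏ (6 d (n₀+1) max(1,(n₀+1)A/r))ˡ`. [cite: OsterwalderSchraderCMP1975, Ch. VI.1 (6.12), (6.17)] -/
theorem seminorm_frameProfile_le (hr1 : r ≤ 1) (v : Fin d → ℝ) {k l : ℕ} (hk : k ≤ n₀) (hl : l ≤ n₀) :
    SchwartzMap.seminorm ℝ k l (frameProfile ê hli n₀ hr v) ≤
      frameJac ê hli * (2 * (((n₀ : ℝ) + 1) / r)) ^ d *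
        (‖(frameMap ê hli : EuclideanSpace ℝ (Fin d) →L[ℝ] EuclideanSpace ℝ (Fin d))‖ * (2 * Real.sqrt d)) ^ k *
        (‖((frameMap ê hli).symm : EuclideanSpace ℝ (Fin d) →L[ℝ] EuclideanSpace ℝ (Fin d))‖ *
          ((d : ℝ) * (6 * ((n₀ : ℝ) + 1) * max 1 (((n₀ : ℝ) + 1) / r * baseDerivL1)))) ^ l := by
  rw [frameProfile, map_smul_eq_mul, Real.norm_eq_abs, abs_of_nonneg (frameJac_nonneg ê hli)]
  have hcomp := seminorm_compCLMOfContinuousLinearEquiv_le (frameMap ê hli).symm (prodProfile n₀ hr v) k l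
  have hprof := seminorm_prodProfile_le n₀ hr hr1 v hk hl
  rw [ContinuousLinearEquiv.symm_symm] at hcomp
  have hJ := frameJac_nonneg ê hli
  calc frameJac ê hli * SchwartzMap.seminorm ℝ k l (SchwartzMap.compCLMOfContinuousLinearEquiv ℝ (frameMap ê hli).symm (prodProfile n₀ hr v))
      ≤ frameJac ê hli * (‖(frameMap ê hli : EuclideanSpace ℝ (Fin d) →L[ℝ] EuclideanSpace ℝ (Fin d))‖ ^ k *
          ‖((frameMap ê hli).symm : EuclideanSpace ℝ (Fin d) →L[ℝ] EuclideanSpace ℝ (Fin d))‖ ^ l *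
          ((2 * (((n₀ : ℝ) + 1) / r)) ^ d * (2 * Real.sqrt d) ^ k *
            ((d : ℝ) * (6 * ((n₀ : ℝ) + 1) * max 1 (((n₀ : ℝ) + 1) / r * baseDerivL1))) ^ l)) :=
        mul_le_mul_of_nonneg_left (hcomp.trans (mul_le_mul_of_nonneg_left hprof (by positivity))) hJ
    _ = _ := by simp only [mul_pow]; ring

/-! ### The smearing identity -/

/-- **The smearing identity**: for `F` on configurations, base points `X` and imaginary parts `v`,
`∫ F(X + frameMap∘c) ∏ⱼ prodProfile vⱼ (cⱼ) dc = ∫ F(y) ∏ⱼ frameProfile vⱼ (yⱼ − Xⱼ) dy`. [cite: OsterwalderSchraderCMP1975, Ch. VI.1 (6.5)–(6.6)] -/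
theorem integral_mul_prod_prodProfile_eq (n : ℕ) (F : (Fin n → EuclideanSpace ℝ (Fin d)) → ℂ)
    (X : Fin n → EuclideanSpace ℝ (Fin d)) (v : Fin n → Fin d → ℝ) :
    ∫ c : Fin n → EuclideanSpace ℝ (Fin d), F (fun j => X j + frameMap ê hli (c j)) * ∏ j, prodProfile n₀ hr (v j) (c j) =
      ∫ y : Fin n → EuclideanSpace ℝ (Fin d), F y * ∏ j, frameProfile ê hli n₀ hr (v j) (y j - X j) := by
  have hJ0 : (frameJac ê hli : ℂ) ≠ 0 := by exact_mod_cast (frameJac_pos ê hli).ne'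
  -- the right side in the `c`-coordinates
  have hsub := integral_comp_frameMapPi_add ê hli n X (fun y => F y * ∏ j, frameProfile ê hli n₀ hr (v j) (y j - X j))
  simp only [add_sub_cancel_left, frameProfile_frameMap] at hsub
  -- `∏ (J * p_j) = J^n ∏ p_j`
  have hprod : ∀ c : Fin n → EuclideanSpace ℝ (Fin d), ∏ j, ((frameJac ê hli : ℂ) * prodProfile n₀ hr (v j) (c j)) =
      (frameJac ê hli : ℂ) ^ n * ∏ j, prodProfile n₀ hr (v j) (c j) := fun c => by
    rw [Finset.prod_mul_distrib, Finset.prod_const, Finset.card_univ, Fintype.card_fin]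
  simp_rw [hprod] at hsub
  have hlhs : ∫ c : Fin n → EuclideanSpace ℝ (Fin d), F (fun j => X j + frameMap ê hli (c j)) *
      ((frameJac ê hli : ℂ) ^ n * ∏ j, prodProfile n₀ hr (v j) (c j)) =
      (frameJac ê hli : ℂ) ^ n * ∫ c : Fin n → EuclideanSpace ℝ (Fin d), F (fun j => X j + frameMap ê hli (c j)) *
        ∏ j, prodProfile n₀ hr (v j) (c j) := by
    rw [← integral_const_mul]
    exact integral_congr_ae (Filter.Eventually.of_forall fun c => by ring)
  rw [hlhs, Complex.real_smul, Complex.ofReal_pow] at hsub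
  exact mul_left_cancel₀ (pow_ne_zero n hJ0) hsub

end Literature.MathematicalPhysics.QuantumFieldTheory
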